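import Summits.SmoothPoincare4.SmoothPoincare4.Theorems.SymplecticOrigamiGromovRecognitionRelEndStubCapModelX5

/-!
# Wedge cap for `GromovRecognitionRelEnd` — the embedding `ι` and the cap charts `ηV, ηH, ηC`
(stub `stub_capModel` of line `cross-cap-laurent`, crux `SymplecticOrigami.GromovRecognitionRelEnd`,
item stmt-SmoothPoincare4-11009)

The data of the conclusion of the stub and their properties, in the exact shape of the registered
signature: `ι = inl : M → X` (injective local diffeomorphism, `(J, JX)`-holomorphic), and the three
cap charts `ηV (u, z₂)`, `ηH (z₁, t)`, `ηC (u, t)` of `X` (junk-extended off the polydiscs):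
injective local diffeomorphisms on the polydiscs, glued to the end by `ηV (u, z₂) = ι χ (1/u, z₂)`
etc., with new axis points, in which `JX` is `i ⊕ i`, and which together with `ι(M)` cover `X`.
-/

noncomputable section

-- the registered namespace `Summit.SmoothPoincare4.SmoothPoincare4.Theorems…` repeats a component
set_option linter.dupNamespace false

open scoped Manifold ContDiff Topology
open Set Function Filter TopologicalSpace Literature.Geometry.Kaehler Literature.Geometry.Symplectic
  Literature.Topology.FourManifolds

namespace Summit.SmoothPoincare4.SmoothPoincare4.Theorems.GromovRecognitionRelEnd.CrossCapLaurent

namespace CapModel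

/-- Model space `ℝ⁴ = ℂ²` (coordinates `0,1` = `z₁`, `2,3` = `z₂`). -/
local notation "E4" => EuclideanSpace ℝ (Fin 4)

variable {R₁ : ℝ} [hR : Fact (0 < R₁)]
  {M : Type} [TopologicalSpace M] [T2Space M] [ChartedSpace E4 M] [IsManifold (𝓡 4) ∞ M]
  {sf : MForm (𝓡 4) M ℝ 2} {K : Set M} {R : ℝ} {ψ : M → E4} {χ : E4 → M}
  {J : AlmostComplexStructure (𝓡 4) ∞ M} (H : EndHyp sf K R ψ χ R₁ J) [Nonempty M]

/-! ## The embedding of `M` -/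

/-- **`ι = inl : M → X`.** [folklore] -/
def ι (H : EndHyp sf K R ψ χ R₁ J) : M → (dX H).Glued := (dX H).inl

/-- `ι` is an injective local diffeomorphism and `(J, JX)`-holomorphic. [folklore] -/
theorem ι_props : IsLocalDiffeomorph (𝓡 4) (𝓡 4) ∞ (ι H) ∧ Injective (ι H) ∧
    ∀ (x : M) (v : TangentSpace (𝓡 4) x),
      JX H (ι H x) (mfderiv (𝓡 4) (𝓡 4) (ι H) x v) = mfderiv (𝓡 4) (𝓡 4) (ι H) x (J x v) :=
  ⟨isLocalDiffeomorph_of_emb (dX H).isSmoothEmbedding_inl (dX H).isOpen_range_inl, (dX H).inl_injective,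
    fun x v => GlueJ.glueACS_inl (dX H) x v⟩

/-! ## The three cap charts -/

/-- **The `V`-cap chart** `ηV (u, z₂) = inr (κV (u, z₂))` (junk off `dV`). [folklore] -/
def ηV (H : EndHyp sf K R ψ χ R₁ J) (p : E4) : (dX H).Glued := (dX H).inr (κV (mkV p))
/-- **The `H`-cap chart** `ηH (z₁, t) = inr (κH (z₁, t))`. [folklore] -/
def ηH (H : EndHyp sf K R ψ χ R₁ J) (p : E4) : (dX H).Glued := (dX H).inr (κH (mkH p))
/-- **The corner cap chart** `ηC (u, t) = inr (κC (u, t))`. [folklore] -/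
def ηC (H : EndHyp sf K R ψ χ R₁ J) (p : E4) : (dX H).Glued := (dX H).inr (κC (mkC p))

omit [Nonempty M] in
/-- `inr` of `X` is a local diffeomorphism. [folklore] -/
theorem isLocalDiffeomorphAt_inr (c : Cap R₁) : IsLocalDiffeomorphAt 𝓘(ℝ, E4) (𝓡 4) ∞ (dX H).inr c :=
  isLocalDiffeomorphAt_of_emb (dX H).isSmoothEmbedding_inr (dX H).isOpen_range_inr c

/-- The chart embeddings of the cap are local diffeomorphisms. [folklore] -/
theorem isLocalDiffeomorphAt_κ :
    (∀ b : OV R₁, IsLocalDiffeomorphAt 𝓘(ℝ, E4) 𝓘(ℝ, E4) ∞ (κV : OV R₁ → Cap R₁) b) ∧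
    (∀ b : OH R₁, IsLocalDiffeomorphAt 𝓘(ℝ, E4) 𝓘(ℝ, E4) ∞ (κH : OH R₁ → Cap R₁) b) ∧
    (∀ c : OC R₁, IsLocalDiffeomorphAt 𝓘(ℝ, E4) 𝓘(ℝ, E4) ∞ (κC : OC R₁ → Cap R₁) c) := by
  refine ⟨fun b => ?_, fun b => ?_, fun c => ?_⟩
  · exact (isLocalDiffeomorphAt_of_emb (dVH R₁).isSmoothEmbedding_inl (dVH R₁).isOpen_range_inl b).comp
      _ _ (isLocalDiffeomorphAt_of_emb (dC1 R₁).isSmoothEmbedding_inl (dC1 R₁).isOpen_range_inl (jV₁ b))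
  · exact (isLocalDiffeomorphAt_of_emb (dVH R₁).isSmoothEmbedding_inr (dVH R₁).isOpen_range_inr b).comp
      _ _ (isLocalDiffeomorphAt_of_emb (dC1 R₁).isSmoothEmbedding_inl (dC1 R₁).isOpen_range_inl (jH₁ b))
  · exact isLocalDiffeomorphAt_of_emb (dC1 R₁).isSmoothEmbedding_inr (dC1 R₁).isOpen_range_inr c

/-- `mkC` is injective on `OC`-valued arguments. [folklore] -/
theorem mkC_inj {x y : E4} (hx : x ∈ OC R₁) (hy : y ∈ OC R₁) (h : (mkC x : OC R₁) = mkC y) : x = y := by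
  have := congrArg Subtype.val h
  rwa [mkC, val_toOpens hx, val_toOpens hy] at this

/-! ### The `V`-chart -/

omit [Nonempty M] in
/-- Local diffeomorphism and injectivity of `ηV` on `dV`. [folklore] -/
theorem ηV_localDiffeo_injOn : IsLocalDiffeomorphOn 𝓘(ℝ, E4) (𝓡 4) ∞ (ηV H) (dV R₁) ∧
    Set.InjOn (ηV H) (dV R₁) := by
  refine ⟨fun ⟨p, hp⟩ => ?_, fun p hp q hq h => ?_⟩
  · exact ((isLocalDiffeomorphAt_toOpens (I := 𝓘(ℝ, E4)) (U := OV R₁) (x₀ := oV) hp).comp _ _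
      (isLocalDiffeomorphAt_κ.1 (mkV p))).comp _ _ (isLocalDiffeomorphAt_inr H (κV (mkV p)))
  · have h1 := κV_injective ((dX H).inr_injective h)
    have := congrArg Subtype.val h1
    rwa [mkV, val_toOpens (show p ∈ OV R₁ from hp), val_toOpens (show q ∈ OV R₁ from hq)] at this

omit [Nonempty M] in
/-- **`ηV` is glued to the end**: `ηV (u, z₂) = ι χ (1/u, z₂)` for `u ≠ 0`. [folklore] -/
theorem ηV_eq_ι {p : E4} (hp : p ∈ dV R₁) (h0 : p 0 ≠ 0 ∨ p 1 ≠ 0) : ηV H p = ι H (χ (inv1 p)) := by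
  have h1 : r1 p ≠ 0 := (r1_ne_zero_iff p).2 h0
  have hv : (mkV p : OV R₁).1 = p := val_toOpens (show p ∈ OV R₁ from hp)
  rw [ηV, κV_eq_ofCoord (by rw [hv]; exact h1), hv, inr_ofCoord H (Or.inl (sq_lt_r1_inv1 h1 hp))]
  rfl

omit [Nonempty M] in
/-- **The axis of the `V`-chart is new** (the sphere `{z₁ = ∞}`). [folklore] -/
theorem ηV_axis {p : E4} (h0 : p 0 = 0) (h1 : p 1 = 0) : ηV H p ∉ range (ι H) := by
  have hr : r1 p = 0 := (r1_eq_zero_iff p).2 ⟨h0, h1⟩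
  have hp : p ∈ OV R₁ := by rw [mem_OV, hr]; exact invSq_pos
  have hv : (mkV p : OV R₁).1 = p := val_toOpens hp
  rw [ηV, ι, (dX H).inr_mem_range_inl_iff, dX_target]
  rintro (⟨b, hb, hbb⟩ | ⟨b, hb, hbb⟩)
  · have : b = mkV p := κV_injective hbb
    rw [this] at hb
    exact hb (show r1 (mkV p : OV R₁).1 = 0 by rw [hv, hr])
  · obtain ⟨⟨h, -⟩, -⟩ := κH_eq_κV_iff.1 hbb
    exact h (by rw [hv, hr])

/-- **`JX` is `i ⊕ i` in the `V`-chart.** [folklore] -/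
theorem JX_ηV {p : E4} (hp : p ∈ dV R₁) (q : E4) :
    JX H (ηV H p) (mfderiv 𝓘(ℝ, E4) (𝓡 4) (ηV H) p q) = mfderiv 𝓘(ℝ, E4) (𝓡 4) (ηV H) p (I4 q) := by
  have h1 : MDifferentiableAt 𝓘(ℝ, E4) 𝓘(ℝ, E4) (dX H).inr (κV (mkV p) : Cap R₁) :=
    ((dX H).contMDiff_inr _).mdifferentiableAt (by simp)
  have h2 : MDifferentiableAt 𝓘(ℝ, E4) 𝓘(ℝ, E4) (κV : OV R₁ → Cap R₁) (mkV p) := mdifferentiableAt_κV _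
  have h3 : MDifferentiableAt 𝓘(ℝ, E4) 𝓘(ℝ, E4) (toOpens (OV R₁) oV) p :=
    (contMDiffAt_toOpens (show p ∈ OV R₁ from hp)).mdifferentiableAt (by simp)
  have e : ∀ q : E4, mfderiv 𝓘(ℝ, E4) (𝓡 4) (ηV H) p q = mfderiv 𝓘(ℝ, E4) 𝓘(ℝ, E4) (dX H).inr
      (κV (mkV p) : Cap R₁) (mfderiv 𝓘(ℝ, E4) 𝓘(ℝ, E4) (κV : OV R₁ → Cap R₁) (mkV p) q) := by
    intro q
    have hc2 := mfderiv_comp p h2 h3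
    have hq : mfderiv 𝓘(ℝ, E4) 𝓘(ℝ, E4) (toOpens (OV R₁) oV) p q = q :=
      mfderiv_toOpens_apply (show p ∈ OV R₁ from hp) q
    have s1 := congrArg (fun L : E4 →L[ℝ] E4 => L q) (mfderiv_comp p h1 (h2.comp p h3))
    rw [hc2] at s1
    refine s1.trans ?_
    show mfderiv 𝓘(ℝ, E4) 𝓘(ℝ, E4) (dX H).inr (κV (mkV p) : Cap R₁) (mfderiv 𝓘(ℝ, E4) 𝓘(ℝ, E4)
      (κV : OV R₁ → Cap R₁) (mkV p) (mfderiv 𝓘(ℝ, E4) 𝓘(ℝ, E4) (toOpens (OV R₁) oV) p q)) = _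
    rw [hq]
  rw [e, e]
  exact (GlueJ.glueACS_inr (dX H) (κV (mkV p) : Cap R₁) _).trans (congrArg _ (JCap_κV (mkV p) q))

/-! ### The `H`-chart -/

omit [Nonempty M] in
/-- Local diffeomorphism and injectivity of `ηH` on `dH`. [folklore] -/
theorem ηH_localDiffeo_injOn : IsLocalDiffeomorphOn 𝓘(ℝ, E4) (𝓡 4) ∞ (ηH H) (dH R₁) ∧
    Set.InjOn (ηH H) (dH R₁) := by
  refine ⟨fun ⟨p, hp⟩ => ?_, fun p hp q hq h => ?_⟩
  · exact ((isLocalDiffeomorphAt_toOpens (I := 𝓘(ℝ, E4)) (U := OH R₁) (x₀ := oH) hp).comp _ _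
      (isLocalDiffeomorphAt_κ.2.1 (mkH p))).comp _ _ (isLocalDiffeomorphAt_inr H (κH (mkH p)))
  · have h1 := κH_injective ((dX H).inr_injective h)
    have := congrArg Subtype.val h1
    rwa [mkH, val_toOpens (show p ∈ OH R₁ from hp), val_toOpens (show q ∈ OH R₁ from hq)] at this

omit [Nonempty M] in
/-- **`ηH` is glued to the end**: `ηH (z₁, t) = ι χ (z₁, 1/t)` for `t ≠ 0`. [folklore] -/
theorem ηH_eq_ι {p : E4} (hp : p ∈ dH R₁) (h0 : p 2 ≠ 0 ∨ p 3 ≠ 0) : ηH H p = ι H (χ (inv2 p)) := by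
  have h2 : r2 p ≠ 0 := (r2_ne_zero_iff p).2 h0
  have hv : (mkH p : OH R₁).1 = p := val_toOpens (show p ∈ OH R₁ from hp)
  rw [ηH, κH_eq_ofCoord (by rw [hv]; exact h2), hv, inr_ofCoord H (Or.inr (sq_lt_r2_inv2 h2 hp))]
  rfl

omit [Nonempty M] in
/-- **The axis of the `H`-chart is new** (the sphere `{z₂ = ∞}`). [folklore] -/
theorem ηH_axis {p : E4} (h2 : p 2 = 0) (h3 : p 3 = 0) : ηH H p ∉ range (ι H) := by
  have hr : r2 p = 0 := (r2_eq_zero_iff p).2 ⟨h2, h3⟩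
  have hp : p ∈ OH R₁ := by rw [mem_OH, hr]; exact invSq_pos
  have hv : (mkH p : OH R₁).1 = p := val_toOpens hp
  rw [ηH, ι, (dX H).inr_mem_range_inl_iff, dX_target]
  rintro (⟨b, hb, hbb⟩ | ⟨b, hb, hbb⟩)
  · obtain ⟨⟨h1, hlt⟩, hmk⟩ := κH_eq_κV_iff.1 hbb.symm
    have heq : inv12 b.1 = p := mkH_inj (inv12_mapsV b.2 h1 hlt).1 hp hmk
    have : r2 p = (r2 b.1)⁻¹ := by rw [← heq, r2_inv12]
    exact inv_ne_zero (r2_ne_zero_of_sq_lt hlt) (this.symm.trans hr)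
  · have : b = mkH p := κH_injective hbb
    rw [this] at hb
    exact hb (show r2 (mkH p : OH R₁).1 = 0 by rw [hv, hr])

/-- **`JX` is `i ⊕ i` in the `H`-chart.** [folklore] -/
theorem JX_ηH {p : E4} (hp : p ∈ dH R₁) (q : E4) :
    JX H (ηH H p) (mfderiv 𝓘(ℝ, E4) (𝓡 4) (ηH H) p q) = mfderiv 𝓘(ℝ, E4) (𝓡 4) (ηH H) p (I4 q) := by
  have h1 : MDifferentiableAt 𝓘(ℝ, E4) 𝓘(ℝ, E4) (dX H).inr (κH (mkH p) : Cap R₁) :=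
    ((dX H).contMDiff_inr _).mdifferentiableAt (by simp)
  have h2 : MDifferentiableAt 𝓘(ℝ, E4) 𝓘(ℝ, E4) (κH : OH R₁ → Cap R₁) (mkH p) := mdifferentiableAt_κH _
  have h3 : MDifferentiableAt 𝓘(ℝ, E4) 𝓘(ℝ, E4) (toOpens (OH R₁) oH) p :=
    (contMDiffAt_toOpens (show p ∈ OH R₁ from hp)).mdifferentiableAt (by simp)
  have e : ∀ q : E4, mfderiv 𝓘(ℝ, E4) (𝓡 4) (ηH H) p q = mfderiv 𝓘(ℝ, E4) 𝓘(ℝ, E4) (dX H).inr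
      (κH (mkH p) : Cap R₁) (mfderiv 𝓘(ℝ, E4) 𝓘(ℝ, E4) (κH : OH R₁ → Cap R₁) (mkH p) q) := by
    intro q
    have hc2 := mfderiv_comp p h2 h3
    have hq : mfderiv 𝓘(ℝ, E4) 𝓘(ℝ, E4) (toOpens (OH R₁) oH) p q = q :=
      mfderiv_toOpens_apply (show p ∈ OH R₁ from hp) q
    have s1 := congrArg (fun L : E4 →L[ℝ] E4 => L q) (mfderiv_comp p h1 (h2.comp p h3))
    rw [hc2] at s1
    refine s1.trans ?_
    show mfderiv 𝓘(ℝ, E4) 𝓘(ℝ, E4) (dX H).inr (κH (mkH p) : Cap R₁) (mfderiv 𝓘(ℝ, E4) 𝓘(ℝ, E4)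
      (κH : OH R₁ → Cap R₁) (mkH p) (mfderiv 𝓘(ℝ, E4) 𝓘(ℝ, E4) (toOpens (OH R₁) oH) p q)) = _
    rw [hq]
  rw [e, e]
  exact (GlueJ.glueACS_inr (dX H) (κH (mkH p) : Cap R₁) _).trans (congrArg _ (JCap_κH (mkH p) q))

/-! ### The corner chart -/

omit [Nonempty M] in
/-- Local diffeomorphism and injectivity of `ηC` on `dC`. [folklore] -/
theorem ηC_localDiffeo_injOn : IsLocalDiffeomorphOn 𝓘(ℝ, E4) (𝓡 4) ∞ (ηC H) (dC R₁) ∧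
    Set.InjOn (ηC H) (dC R₁) := by
  refine ⟨fun ⟨p, hp⟩ => ?_, fun p hp q hq h => ?_⟩
  · exact ((isLocalDiffeomorphAt_toOpens (I := 𝓘(ℝ, E4)) (U := OC R₁) (x₀ := oC) hp).comp _ _
      (isLocalDiffeomorphAt_κ.2.2 (mkC p))).comp _ _ (isLocalDiffeomorphAt_inr H (κC (mkC p)))
  · exact mkC_inj hp hq ((dC1 R₁).inr_injective ((dX H).inr_injective h))

omit [Nonempty M] in
/-- **`ηC = ηV ∘ (t ↦ 1/t)`** off the axis `t = 0`. [folklore] -/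
theorem ηC_eq_ηV {p : E4} (hp : p ∈ dC R₁) (h0 : p 2 ≠ 0 ∨ p 3 ≠ 0) : ηC H p = ηV H (inv2 p) := by
  have h2 : r2 p ≠ 0 := (r2_ne_zero_iff p).2 h0
  have hv : (mkC p : OC R₁).1 = p := val_toOpens (show p ∈ OC R₁ from hp)
  rw [ηC, ηV, (κC_eq_κV_of_ne (c := mkC p) (by rw [hv]; exact h2)).1, hv]

omit [Nonempty M] in
/-- **`ηC = ηH ∘ (u ↦ 1/u)`** off the axis `u = 0`. [folklore] -/
theorem ηC_eq_ηH {p : E4} (hp : p ∈ dC R₁) (h0 : p 0 ≠ 0 ∨ p 1 ≠ 0) : ηC H p = ηH H (inv1 p) := by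
  have h1 : r1 p ≠ 0 := (r1_ne_zero_iff p).2 h0
  have hv : (mkC p : OC R₁).1 = p := val_toOpens (show p ∈ OC R₁ from hp)
  have hm : inv1 p ∈ OH R₁ := by rw [mem_OH, r2_inv1]; exact hp.2
  rw [ηC, ηH]
  congr 1
  rw [κC_eq_κH_iff, mkH, val_toOpens hm]
  refine ⟨sq_lt_r1_inv1 h1 hp.1, ?_⟩
  apply Subtype.ext
  rw [mkC, val_toOpens (by rw [inv1_inv1 h1]; exact hp), inv1_inv1 h1]
  exact (val_toOpens (show p ∈ OC R₁ from hp)).symm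

omit [Nonempty M] in
/-- **The corner is new.** [folklore] -/
theorem ηC_zero : ηC H 0 ∉ range (ι H) := by
  have h0 : (0 : E4) ∈ OC R₁ := oC.2
  have hv : (mkC (0 : E4) : OC R₁) = oC := Subtype.ext (val_toOpens h0)
  rw [ηC, ι, (dX H).inr_mem_range_inl_iff, dX_target]
  rintro (⟨b, hb, hbb⟩ | ⟨b, hb, hbb⟩)
  · obtain ⟨h2, hmk⟩ := κC_eq_κV_iff.1 hbb.symm
    have heq : inv2 b.1 = 0 := mkC_inj (inv2_mapsV b.2 h2).1 h0 hmk
    have : r1 b.1 = 0 := by rw [← r1_inv2 b.1, heq, r1_def]; simp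
    exact hb this
  · obtain ⟨h1, hmk⟩ := κC_eq_κH_iff.1 hbb.symm
    have heq : inv1 b.1 = 0 := mkC_inj (inv1_mapsH b.2 h1).1 h0 hmk
    have : r2 b.1 = 0 := by rw [← r2_inv1 b.1, heq, r2_def]; simp
    exact hb this

/-- **`JX` is `i ⊕ i` in the corner chart.** [folklore] -/
theorem JX_ηC {p : E4} (hp : p ∈ dC R₁) (q : E4) :
    JX H (ηC H p) (mfderiv 𝓘(ℝ, E4) (𝓡 4) (ηC H) p q) = mfderiv 𝓘(ℝ, E4) (𝓡 4) (ηC H) p (I4 q) := by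
  have h1 : MDifferentiableAt 𝓘(ℝ, E4) 𝓘(ℝ, E4) (dX H).inr (κC (mkC p) : Cap R₁) :=
    ((dX H).contMDiff_inr _).mdifferentiableAt (by simp)
  have h2 : MDifferentiableAt 𝓘(ℝ, E4) 𝓘(ℝ, E4) (κC : OC R₁ → Cap R₁) (mkC p) :=
    ((dC1 R₁).contMDiff_inr _).mdifferentiableAt (by simp)
  have h3 : MDifferentiableAt 𝓘(ℝ, E4) 𝓘(ℝ, E4) (toOpens (OC R₁) oC) p :=
    (contMDiffAt_toOpens (show p ∈ OC R₁ from hp)).mdifferentiableAt (by simp)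
  have e : ∀ q : E4, mfderiv 𝓘(ℝ, E4) (𝓡 4) (ηC H) p q = mfderiv 𝓘(ℝ, E4) 𝓘(ℝ, E4) (dX H).inr
      (κC (mkC p) : Cap R₁) (mfderiv 𝓘(ℝ, E4) 𝓘(ℝ, E4) (κC : OC R₁ → Cap R₁) (mkC p) q) := by
    intro q
    have hc2 := mfderiv_comp p h2 h3
    have hq : mfderiv 𝓘(ℝ, E4) 𝓘(ℝ, E4) (toOpens (OC R₁) oC) p q = q :=
      mfderiv_toOpens_apply (show p ∈ OC R₁ from hp) q
    have s1 := congrArg (fun L : E4 →L[ℝ] E4 => L q) (mfderiv_comp p h1 (h2.comp p h3))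
    rw [hc2] at s1
    refine s1.trans ?_
    show mfderiv 𝓘(ℝ, E4) 𝓘(ℝ, E4) (dX H).inr (κC (mkC p) : Cap R₁) (mfderiv 𝓘(ℝ, E4) 𝓘(ℝ, E4)
      (κC : OC R₁ → Cap R₁) (mkC p) (mfderiv 𝓘(ℝ, E4) 𝓘(ℝ, E4) (toOpens (OC R₁) oC) p q)) = _
    rw [hq]
  rw [e, e]
  exact (GlueJ.glueACS_inr (dX H) (κC (mkC p) : Cap R₁) _).trans (congrArg _ (JCap_κC (mkC p) q))

/-! ## The cover -/

omit [Nonempty M] in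
/-- **`ι(M)` and the three cap charts cover `X`.** [folklore] -/
theorem cover_X (y : (dX H).Glued) : y ∈ range (ι H) ∨ (∃ p : E4, p ∈ dV R₁ ∧ ηV H p = y) ∨
    (∃ p : E4, p ∈ dH R₁ ∧ ηH H p = y) ∨ (∃ p : E4, p ∈ dC R₁ ∧ ηC H p = y) := by
  rcases (dX H).exists_inl_or_inr y with ⟨x, rfl⟩ | ⟨c, rfl⟩
  · exact Or.inl ⟨x, rfl⟩
  rcases (dC1 R₁).exists_inl_or_inr c with ⟨y₁, rfl⟩ | ⟨c', rfl⟩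
  · rcases (dVH R₁).exists_inl_or_inr y₁ with ⟨b, rfl⟩ | ⟨b, rfl⟩
    · exact Or.inr (Or.inl ⟨b.1, b.2, by rw [ηV, mkV, toOpens_val]; rfl⟩)
    · exact Or.inr (Or.inr (Or.inl ⟨b.1, b.2, by rw [ηH, mkH, toOpens_val]; rfl⟩))
  · exact Or.inr (Or.inr (Or.inr ⟨c'.1, c'.2, by rw [ηC, mkC, toOpens_val]⟩))

end CapModel

/-- **Registered helper sub-goal `helper_capModelVChart`** (file `X6` of stub `stub_capModel`): under the
hypotheses of the stub, the sphere chart `ηV (u, z₂)` of the closed model — an injective local diffeomorphism on the polydisc, glued to the end by `ηV (u, z₂) = ι χ (1/u, z₂)`, with new axis. [folklore] -/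
theorem helper_capModelVChart :
    ∀ (M : Type) [TopologicalSpace M] [T2Space M] [SecondCountableTopology M]
      [ChartedSpace (EuclideanSpace ℝ (Fin 4)) M] [IsManifold (𝓡 4) ∞ M] [ConnectedSpace M]
      (sf : Literature.Geometry.Kaehler.MForm (𝓡 4) M ℝ 2) (K : Set M) (R : ℝ)
      (ψ : M → EuclideanSpace ℝ (Fin 4)) (χ : EuclideanSpace ℝ (Fin 4) → M),
      Literature.Geometry.Kaehler.IsSmoothForm sf → Literature.Geometry.Kaehler.IsClosedForm sf →
      (∀ x (v : TangentSpace (𝓡 4) x), v ≠ 0 → ∃ w, sf x ![v, w] ≠ 0) →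
      (∀ R', R ≤ R' → IsCompact (K ∪ {x | ‖ψ x‖ ≤ R'})) →
      ContMDiffOn (𝓡 4) 𝓘(ℝ, EuclideanSpace ℝ (Fin 4)) ∞ ψ Kᶜ →
      ContMDiffOn 𝓘(ℝ, EuclideanSpace ℝ (Fin 4)) (𝓡 4) ∞ χ
        (Metric.closedBall (0 : EuclideanSpace ℝ (Fin 4)) R)ᶜ →
      Set.BijOn ψ Kᶜ (Metric.closedBall (0 : EuclideanSpace ℝ (Fin 4)) R)ᶜ →
      (∀ x, x ∈ Kᶜ → χ (ψ x) = x) →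
      (∀ x, x ∈ Kᶜ → ∀ v w, sf x ![v, w] = Literature.Geometry.Symplectic.stdSymplecticForm
        (mfderiv (𝓡 4) 𝓘(ℝ, EuclideanSpace ℝ (Fin 4)) ψ x v)
        (mfderiv (𝓡 4) 𝓘(ℝ, EuclideanSpace ℝ (Fin 4)) ψ x w)) →
      (∀ R', R < R' → IsOpen (K ∪ {x | x ∈ Kᶜ ∧ ‖ψ x‖ < R'})) →
      ∀ (R₁ : ℝ) (J : Literature.Geometry.Symplectic.AlmostComplexStructure (𝓡 4) ∞ M),
      R < R₁ → 0 < R₁ → J.IsTamedBy sf →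
      (∀ x, x ∈ Kᶜ → R₁ < ‖ψ x‖ → ∀ (v : TangentSpace (𝓡 4) x) (a : EuclideanSpace ℝ (Fin 4)),
          a = mfderiv (𝓡 4) 𝓘(ℝ, EuclideanSpace ℝ (Fin 4)) ψ x v →
          mfderiv (𝓡 4) 𝓘(ℝ, EuclideanSpace ℝ (Fin 4)) ψ x (J x v) =
            WithLp.toLp 2 ![-(a 1), a 0, -(a 3), a 2]) →
      ∃ (X : Type) (_ : TopologicalSpace X) (_ : ChartedSpace (EuclideanSpace ℝ (Fin 4)) X)
        (_ : IsManifold (𝓡 4) ∞ X) (ι : M → X) (ηV : EuclideanSpace ℝ (Fin 4) → X),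
        IsLocalDiffeomorphOn 𝓘(ℝ, EuclideanSpace ℝ (Fin 4)) (𝓡 4) ∞ ηV
            {p : EuclideanSpace ℝ (Fin 4) | p 0 ^ 2 + p 1 ^ 2 < R₁⁻¹ ^ 2} ∧
          Set.InjOn ηV {p : EuclideanSpace ℝ (Fin 4) | p 0 ^ 2 + p 1 ^ 2 < R₁⁻¹ ^ 2} ∧
          (∀ p : EuclideanSpace ℝ (Fin 4), p 0 ^ 2 + p 1 ^ 2 < R₁⁻¹ ^ 2 → (p 0 ≠ 0 ∨ p 1 ≠ 0) →
            ηV p = ι (χ (WithLp.toLp 2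
              ![p 0 / (p 0 ^ 2 + p 1 ^ 2), -(p 1) / (p 0 ^ 2 + p 1 ^ 2), p 2, p 3]))) ∧
          (∀ p : EuclideanSpace ℝ (Fin 4), p 0 = 0 → p 1 = 0 → ηV p ∉ Set.range ι) := by
  intro M _ _ _ _ _ _ sf K R ψ χ h2 h3 h4 h5 h6 h7 h8 h9 h10 hopen R₁ J hR₁ hR₁pos hJt hJstd
  haveI : Fact (0 < R₁) := ⟨hR₁pos⟩
  let H : CapModel.EndHyp sf K R ψ χ R₁ J :=
    { smooth := h2, closed := h3, nondeg := h4, ends := h5, smooth_ψ := h6, smooth_χ := h7, bij := h8,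
      left_inv := h9, pullback_eq := h10, isOpen_trunc := hopen, lt_R₁ := hR₁, R₁_pos := hR₁pos,
      tame := hJt, Jstd := hJstd }
  exact ⟨(CapModel.dX H).Glued, inferInstance, inferInstance, inferInstance, CapModel.ι H, CapModel.ηV H,
    (CapModel.ηV_localDiffeo_injOn H).1, (CapModel.ηV_localDiffeo_injOn H).2,
    fun p hp h0 => CapModel.ηV_eq_ι H hp h0, fun p h0 h1 => CapModel.ηV_axis H h0 h1⟩

end Summit.SmoothPoincare4.SmoothPoincare4.Theorems.GromovRecognitionRelEnd.CrossCapLaurent
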